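import Summits.ValiantsHypothesis.ValiantsHypothesis.Theorems.BarrierLeverDefinableDcEquationsLowOrderVanishing
import Summits.ValiantsHypothesis.ValiantsHypothesis.Theorems.BarrierLeverDefinableDcEquationsDegreeThreshold
import Summits.ValiantsHypothesis.ValiantsHypothesis.Theorems.BarrierLeverNaturalProofsAgainstAllLinearSizesOfCount

/-!
# Route BarrierLever — algebraic natural proofs against determinantal complexity `n + k`, every
# constant `k` (crux `DefinableDcEquations`, stmt-ValiantsHypothesis-8746, thresholds `m(n) ≤ n + k`)

The rank-4 crux `DefinableDcEquations` asks for boolean-sum (`VNP(N)`-explicit) equations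
vanishing on the coefficient vectors of `{f ∈ ℂ[x₁..xₙ] : deg f ≤ n, dc f ≤ m(n)}` for a
super-quasi-quadratic threshold `m`.  The tree settles the thresholds `m(n) < n` (trivial) and
`m(n) = n` (`BarrierLeverDefinableDcEquationsDegreeThreshold.lean`, Alper–Bogart–Velasco's
`codim Sing ≤ 4`).  This file settles **every threshold `m(n) ≤ n + k`, `k` a constant**, with the
SAME certificate family (the cell's Macaulay certificate `certPoly n w` of item 20156) on a window of
`w = (k+2)² + 1` coordinates, unconditionally and with a `poly(n)`-size witness:

* `eval_certPoly_eq_zero_of_dc_le_add` — for `w > (k+2)²`, `n ≥ 2`, and every `f` with `deg f ≤ n`,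
  `dc f ≤ n + k`: `certPoly n w` vanishes at `coeff f`.  Mechanism (support file
  `…LowOrderVanishing.lean`): `f = det (M₀ + M₁(x))` of size `n + k`; restricted to `w` coordinates
  the linear part `M₁` has, by **Eagon–Northcott** (height of the ideal of `(n-1)`-minors
  `≤ (k+2)² < w`, Matsumura Thm. 13.10 PROVED in the tree), a point `ξ ≠ 0` of corank `≥ k + 2`;
  there the degree-`n` component `g = Σ_{#T=k} det(columns T from M₀, others from M₁)` of the
  restriction and its gradient vanish (every term Laplace-expands into `(n-1)`-minors of `M₁(ξ)`),
  so `∇g` has a nonzero common zero and the Macaulay determinant of `∇g` is `0`.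
* `certPoly_mem_distinguishers_window` (level `14w + 11`, from the cell's `size_arith`; true size
  `n^{O(w)} = polylog N`), `isNaturalProof_certPoly_of_dc_le_add`,
  `not_isSuccinctHittingSet_dc_le_add`, `naturalProofsAgainstDcPlusConst` (`∀ k ∃ a n₀ ∀ n ≥ n₀`,
  the signature recorded as a candidate rung by the previous seat), and
  `dcEquations_of_threshold_le_add_const` — the equation clause of `DefinableDcEquations` for
  every threshold function `m` with `m(n) ≤ n + k` eventually (level `a = 14((k+2)²+1)+11`, `q = 0`).

Honest framing: the crux asks for `m(n) ≥ 2^(C log² n)`; here `m(n) ≤ n + O(1)` (the window must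
exceed the Eagon–Northcott codimension `(k+2)²`, so the certificate has size `n^{Θ(k²)}`; the
Kumar–Volk degree-trading route would give a window `2k + 8` but is not needed for constant `k`).
Known lower bounds for `dc` of explicit forms (`1.5n - 3`, Kumar–Volk) are inputs of a different
kind: the content here is the FSV-constructivity of equations for the slice.  Nothing here bears on
`VP` vs `VNP`.  No definitions, no named facts; standard axioms.

References: H. Matsumura, *Commutative Ring Theory*, Thm. 13.10 [Matsumura1987]; M. Forbes,
A. Shpilka, B. L. Volk, *Succinct hitting sets and barriers to proving lower bounds for algebraic
circuits*, Theory of Computing 14 (2018), Def. 1.1 / Thm. 4 [ForbesShpilkaVolk2018]; D. Cox,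
J. Little, D. O'Shea, *Using Algebraic Geometry*, Ch. 3 §4 [CoxLittleOSheaUsing2005].
-/

-- layout Summits/ValiantsHypothesis/ValiantsHypothesis forces the duplicated namespace component
set_option linter.dupNamespace false

noncomputable section

open MvPolynomial Finset Matrix

namespace Summit.ValiantsHypothesis.ValiantsHypothesis.Theorems.BarrierLever.DcConstantExcess

open Literature.Computability.AlgebraicComplexity
open Literature.RingTheory.MvPolynomial.Macaulay
open Literature.RingTheory.KrullDimension
open Literature.Barriers.ValiantsHypothesis
open Summit.ValiantsHypothesis.ValiantsHypothesis.Theorems.BarrierLever.NaturalProofsAgainstAllLinearSizes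
open Summit.ValiantsHypothesis.ValiantsHypothesis.Theorems.BarrierLever.DcEqualsDegree

/-! ## §5 The Macaulay certificate vanishes on `{deg f ≤ n, dc f ≤ n + k}` -/

/-- **The certificate vanishes on determinantal expressions of size `n + k`.**  For a window
`w > (k+2)²` and every `f ∈ ℂ[x₁..xₙ]` (`n ≥ 2`) with `deg f ≤ n` and `dc f ≤ n + k`, the cell's
Macaulay certificate `certPoly n w` (item 20156's distinguisher: the determinant of the Macaulay
matrix of `∇ (f(x₁,…,x_w,0,…,0))_n`) VANISHES at `coeff f`.  Proof: `f = det M`, `M` affine of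
size `n + k` (`hasDetRepr_iff_determinantalComplexity_le`); restrict to the first `w` coordinates;
the linear part `M₁` is an `(n+k) × (n+k)` matrix of linear forms in `w > (k+2)²` variables, so
some `ξ ≠ 0` kills all its `(n-1)`-minors (`exists_ne_zero_minorsIdeal_eval_eq_bot`); there the
gradient of the degree-`n` component of the restriction vanishes
(`eval_pderiv_homogeneousComponent_det_eq_zero`), and a nonzero common zero of the gradient of a
form kills the Macaulay determinant (`Macaulay.det_macaulay_grad_eq_zero`, `eval_certPoly`).
The case `k = 0`, `w = 5` is the tree's `DcEqualsDegree.eval_certPoly_five_eq_zero_of_dc_le`.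
[cite: Matsumura1987, Thm. 13.10] -/
theorem eval_certPoly_eq_zero_of_dc_le_add {n k w : ℕ} (hw : (k + 2) * (k + 2) < w) (hn : 2 ≤ n)
    (f : MvPolynomial (Fin n) ℂ) (hdeg : f.totalDegree ≤ n)
    (hdc : determinantalComplexity f ≤ n + k) :
    eval (coeffVector (degLEMonomials n) f) (certPoly n w) = 0 := by
  classical
  obtain ⟨M, hM1, hMdet⟩ := (hasDetRepr_iff_determinantalComplexity_le_holds f (n + k)).2 hdc
  -- restriction to the first `w` coordinates
  let ρ : MvPolynomial (Fin n) ℂ →ₐ[ℂ] MvPolynomial (Fin w) ℂ := aeval (restr ℂ n w)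
  have hM'1 : ∀ i j, ((ρ.mapMatrix M) i j).totalDegree ≤ 1 := fun i j =>
    (totalDegree_aeval_restr_le (M i j)).trans (hM1 i j)
  have hdet' : (ρ.mapMatrix M).det = ρ f := by
    rw [← AlgHom.map_det, hMdet]
  -- a nonzero point of corank `≥ k + 2` of the linear part
  have hL : ∀ i j, (((ρ.mapMatrix M).map (homogeneousComponent 1)) i j).IsHomogeneous 1 :=
    fun i j => homogeneousComponent_isHomogeneous 1 _
  obtain ⟨ξ, hξ, hmin⟩ := exists_ne_zero_minorsIdeal_eval_eq_bot _ hL (t := n - 1) (by omega)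
    (by
      have h : n + k - (n - 1) + 1 = k + 2 := by omega
      rw [h]
      exact hw)
  rw [eval_certPoly w f hdeg]
  refine det_macaulay_grad_eq_zero _ (homogeneousComponent_isHomogeneous n _) ξ hξ fun i => ?_
  show eval ξ (pderiv i (homogeneousComponent n (ρ f))) = 0
  rw [← hdet']
  exact eval_pderiv_homogeneousComponent_det_eq_zero rfl (by omega) _ hM'1 ξ hmin i

/-! ## §6 Packaging: distinguisher size, natural proofs, the crux's clause for thresholds `≤ n + k` -/

/-- **The certificate with window `w` is a legitimate distinguisher of level `14 w + 11`** (size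
and degree `≤ N^(14w+11)`, `N = C(2n,n)`; in fact size `n^{O(w)} = polylog N`): `R = #mons ≤ n^(2w)`
(`card_mons_critDeg_le`), `#degLEMonomials n ≤ N`, and the cell's `size_arith`. [folklore] -/
theorem certPoly_mem_distinguishers_window {n w : ℕ} (hw1 : 1 ≤ w) (hwn : w ≤ n) (hn : 2 ≤ n) :
    certPoly n w ∈ Distinguishers ℂ n (14 * w + 11) := by
  obtain ⟨hB, hnB⟩ := two_le_centralChoose_and_le (n := n) (by omega)
  have hR : (mons w (critDeg w (n - 1))).card ≤ (2 * n).choose n ^ (2 * w) :=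
    (card_mons_critDeg_le hw1 hwn hn).trans (Nat.pow_le_pow_left hnB _)
  obtain ⟨h1, h2⟩ := size_arith hB hR (card_degLEMonomials_le_choose n)
  have he : 7 * (2 * w) + 11 = 14 * w + 11 := by ring
  rw [he] at h1 h2
  exact certPoly_mem_distinguishers h1 h2

/-- **An algebraic natural proof against `dc ≤ n + k`** (FSV Def. 1): for every window
`w > (k+2)²` and every `n ≥ w`, `certPoly n w` is a nonzero level-`(14w+11)` distinguisher
vanishing on the coefficient vectors of all `f ∈ ℂ[x₁..xₙ]` with `deg f ≤ n` and `dc f ≤ n + k`.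
[cite: Matsumura1987, Thm. 13.10] -/
theorem isNaturalProof_certPoly_of_dc_le_add {n k w : ℕ} (hw : (k + 2) * (k + 2) < w)
    (hwn : w ≤ n) :
    IsNaturalProof (degLEMonomials n)
      {f : MvPolynomial (Fin n) ℂ | f.totalDegree ≤ n ∧ determinantalComplexity f ≤ n + k}
      (Distinguishers ℂ n (14 * w + 11)) (certPoly n w) :=
  ⟨certPoly_mem_distinguishers_window (by nlinarith) hwn (by nlinarith),
    certPoly_ne_zero (by nlinarith) hwn,
    fun f hf => eval_certPoly_eq_zero_of_dc_le_add hw (by nlinarith) f hf.1 hf.2⟩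

/-- **Hitting-set reading**: for `w > (k+2)²` and `n ≥ w`, the degree-`≤ n` polynomials of
determinantal complexity `≤ n + k` are NOT a succinct hitting set for `Distinguishers ℂ n (14w+11)`.
[cite: ForbesShpilkaVolk2018, Thm. 4] -/
theorem not_isSuccinctHittingSet_dc_le_add {n k w : ℕ} (hw : (k + 2) * (k + 2) < w)
    (hwn : w ≤ n) :
    ¬ IsSuccinctHittingSet (degLEMonomials n)
      {f : MvPolynomial (Fin n) ℂ | f.totalDegree ≤ n ∧ determinantalComplexity f ≤ n + k}
      (Distinguishers ℂ n (14 * w + 11)) := by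
  rw [← exists_isNaturalProof_iff]
  exact ⟨certPoly n w, isNaturalProof_certPoly_of_dc_le_add hw hwn⟩

/-- **Natural proofs against determinantal complexity `n + k`, for EVERY constant `k`** (the
`dc`-axis rung the crux lead's census asked for, `NaturalProofsAgainstDcPlusConst`): for every `k`
there are a level `a = 14((k+2)²+1) + 11` and `n₀ = (k+2)² + 1` such that for all `n ≥ n₀` the
slice `{deg f ≤ n, dc f ≤ n + k}` is not a succinct hitting set for `Distinguishers ℂ n a` —
i.e. it carries a nonzero `poly(N)`-size (indeed `poly(n)`-size) equation.  Honest framing: known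
LOWER bounds for `dc` of explicit degree-`n` forms in `n` variables reach `1.5 n - 3`
(Kumar–Volk); the content here is the FSV-constructivity of equations for the slice, not a bound.
[cite: Matsumura1987, Thm. 13.10] -/
theorem naturalProofsAgainstDcPlusConst (k : ℕ) :
    ∃ a n₀ : ℕ, ∀ n ≥ n₀, ¬ IsSuccinctHittingSet (degLEMonomials n)
      {f : MvPolynomial (Fin n) ℂ | f.totalDegree ≤ n ∧ determinantalComplexity f ≤ n + k}
      (Distinguishers ℂ n a) :=
  ⟨14 * ((k + 2) * (k + 2) + 1) + 11, (k + 2) * (k + 2) + 1, fun _ hn =>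
    not_isSuccinctHittingSet_dc_le_add (Nat.lt_succ_self _) hn⟩

/-- **The equation clause of the crux `DefinableDcEquations` for every threshold `m(n) ≤ n + k`.**
For EVERY constant `k` and every threshold function `m` eventually bounded by `n + k`
(`m n ≤ n + k` for `n ≥ n₁`), the inner statement of `BarrierLever.DefinableDcEquations` holds:
level `a = 14((k+2)²+1) + 11`, from `n₀ = max n₁ ((k+2)²+1)`, with `q = 0` boolean variables and
`H = certPoly n ((k+2)²+1)` (`boolSum H = H`).  The crux asks for `m(n) ≥ 2^(C (log₂ n + 1)²)`
eventually for every `C`; this settles the partial range `m(n) ≤ n + O(1)` (the tree had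
`m(n) ≤ n`, `DcEqualsDegree.dcEquations_of_threshold_le_degree`). [cite: Matsumura1987, Thm. 13.10] -/
theorem dcEquations_of_threshold_le_add_const (k : ℕ) (m : ℕ → ℕ) {n₁ : ℕ}
    (hm : ∀ n, n₁ ≤ n → m n ≤ n + k) :
    ∃ a n₀ : ℕ, ∀ n ≥ n₀, ∃ q : ℕ, q ≤ (Nat.choose (2 * n) n) ^ a ∧
      ∃ H : MvPolynomial (↥(degLEMonomials n) ⊕ Fin q) ℂ,
        complexity H ≤ (Nat.choose (2 * n) n) ^ a ∧ H.totalDegree ≤ (Nat.choose (2 * n) n) ^ a ∧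
        boolSum H ≠ 0 ∧
        ∀ f : MvPolynomial (Fin n) ℂ, f.totalDegree ≤ n → determinantalComplexity f ≤ m n →
          eval (coeffVector (degLEMonomials n) f) (boolSum H) = 0 := by
  set w := (k + 2) * (k + 2) + 1 with hwdef
  have hw : (k + 2) * (k + 2) < w := Nat.lt_succ_self _
  refine ⟨14 * w + 11, max n₁ w, fun n hn => ⟨0, Nat.zero_le _, rename Sum.inl (certPoly n w),
    ?_, ?_, ?_, ?_⟩⟩
  · exact (complexity_rename_le_holds' _ _).trans
      (isNaturalProof_certPoly_of_dc_le_add hw ((le_max_right _ _).trans hn)).1.1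
  · exact (totalDegree_rename_le _ _).trans
      (isNaturalProof_certPoly_of_dc_le_add hw ((le_max_right _ _).trans hn)).1.2
  · rw [boolSum_rename_inl_zero]
    exact (isNaturalProof_certPoly_of_dc_le_add (k := k) hw ((le_max_right _ _).trans hn)).2.1
  · intro f hdeg hdc
    rw [boolSum_rename_inl_zero]
    exact (isNaturalProof_certPoly_of_dc_le_add hw ((le_max_right _ _).trans hn)).2.2 f
      ⟨hdeg, hdc.trans (hm n ((le_max_left _ _).trans hn))⟩


/-! ## §7 Level form: ONE level `14c + 11` for all excesses `k` with `((k+2)²+1)(log₂ n + 1) ≤ c n` -/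

/-- Window arithmetic: if `w (log₂ n + 1) ≤ c n` then
`R = #mons w (w(n-2)+1) ≤ n^(2w) ≤ 2^(2cn) ≤ C(2n,n)^(2c)` (`2^n ≤ C(2n,n)` is the tree's
`two_pow_le_choose_two_mul_self`). [folklore] -/
theorem card_mons_le_of_window {c n w : ℕ} (hn : 2 ≤ n) (hw1 : 1 ≤ w) (hwn : w ≤ n)
    (hw : w * (Nat.log 2 n + 1) ≤ c * n) :
    (mons w (critDeg w (n - 1))).card ≤ (2 * n).choose n ^ (2 * c) := by
  have hlog : n < 2 ^ (Nat.log 2 n + 1) := Nat.lt_pow_succ_log_self (by norm_num) n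
  calc (mons w (critDeg w (n - 1))).card ≤ n ^ (2 * w) := card_mons_critDeg_le hw1 hwn hn
    _ ≤ (2 ^ (Nat.log 2 n + 1)) ^ (2 * w) := Nat.pow_le_pow_left hlog.le _
    _ = 2 ^ (2 * (w * (Nat.log 2 n + 1))) := by rw [← pow_mul]; ring_nf
    _ ≤ 2 ^ (2 * (c * n)) := Nat.pow_le_pow_right (by norm_num) (by omega)
    _ = (2 ^ n) ^ (2 * c) := by rw [← pow_mul]; ring_nf
    _ ≤ (2 * n).choose n ^ (2 * c) := Nat.pow_le_pow_left
        (Literature.ModelTheory.FiniteModelTheory.two_pow_le_choose_two_mul_self n) _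

/-- **The certificate on a window `w` with `w (log₂ n + 1) ≤ c n` is a level-`(14c + 11)`
distinguisher** (its size `n^{O(w)} ≤ 2^{O(cn)} ≤ N^{O(c)}`). [folklore] -/
theorem certPoly_mem_distinguishers_of_window {c n w : ℕ} (hn : 2 ≤ n) (hw1 : 1 ≤ w)
    (hwn : w ≤ n) (hw : w * (Nat.log 2 n + 1) ≤ c * n) :
    certPoly n w ∈ Distinguishers ℂ n (14 * c + 11) := by
  obtain ⟨hB, -⟩ := two_le_centralChoose_and_le (n := n) (by omega)
  obtain ⟨h1, h2⟩ :=
    size_arith hB (card_mons_le_of_window hn hw1 hwn hw) (card_degLEMonomials_le_choose n)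
  have he : 7 * (2 * c) + 11 = 14 * c + 11 := by ring
  rw [he] at h1 h2
  exact certPoly_mem_distinguishers h1 h2

/-- For `n ≥ 2^c` the window hypothesis `w (log₂ n + 1) ≤ c n` forces `w ≤ n`. [folklore] -/
theorem window_le {c n w : ℕ} (hn : 2 ^ c ≤ n) (hw0 : 1 ≤ w)
    (hw : w * (Nat.log 2 n + 1) ≤ c * n) : w ≤ n := by
  have hlogc : c ≤ Nat.log 2 n := by
    have := Nat.log_mono_right (b := 2) hn
    rwa [Nat.log_pow (by norm_num)] at this
  rcases Nat.eq_zero_or_pos c with rfl | hc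
  · have := Nat.mul_pos hw0 (by omega : 0 < Nat.log 2 n + 1)
    omega
  by_contra h
  push Not at h
  have h1 : w * (c + 1) ≤ w * (Nat.log 2 n + 1) := Nat.mul_le_mul_left w (by omega)
  have h2 : c * n < c * w := Nat.mul_lt_mul_of_pos_left h hc
  have h3 : w * (c + 1) = c * w + w := by ring
  omega

/-- **Natural proofs against `dc ≤ n + k` for growing excess `k = k(n)`, level form.**  For every
`c` there is ONE level `a = 14c + 11` such that for all `n ≥ 2^c` and EVERY `k` with
`((k+2)² + 1)(log₂ n + 1) ≤ c·n` — i.e. all excesses `k ≤ √(c n/(log₂ n + 1) - 1) - 2 =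
Θ(√(c n / log n))` — the slice `{deg f ≤ n, dc f ≤ n + k}` is not a succinct hitting set for
`Distinguishers ℂ n a` (witness `certPoly n ((k+2)²+1)`).  The `dc`-axis counterpart of item
20156's window `Θ(c n / log n)` for LINEAR circuit sizes; here the Eagon–Northcott codimension
`(k+2)²` caps the certified excess at `Θ(√(c n / log n))` for `poly(N)` size.
[cite: Matsumura1987, Thm. 13.10] -/
theorem naturalProofsAgainstDcWindowedExcess (c : ℕ) :
    ∃ a n₀ : ℕ, ∀ n ≥ n₀, ∀ k : ℕ, ((k + 2) * (k + 2) + 1) * (Nat.log 2 n + 1) ≤ c * n →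
      ¬ IsSuccinctHittingSet (degLEMonomials n)
        {f : MvPolynomial (Fin n) ℂ | f.totalDegree ≤ n ∧ determinantalComplexity f ≤ n + k}
        (Distinguishers ℂ n a) := by
  refine ⟨14 * c + 11, 2 ^ c, fun n hn k hk => ?_⟩
  have hw : (k + 2) * (k + 2) < (k + 2) * (k + 2) + 1 := Nat.lt_succ_self _
  have hwn : (k + 2) * (k + 2) + 1 ≤ n := window_le hn (by omega) hk
  have hn2 : 2 ≤ n := by nlinarith
  rw [← exists_isNaturalProof_iff]
  exact ⟨certPoly n ((k + 2) * (k + 2) + 1), certPoly_mem_distinguishers_of_window hn2 (by omega) hwn hk,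
    certPoly_ne_zero (by omega) hwn, fun f hf => eval_certPoly_eq_zero_of_dc_le_add hw hn2 f hf.1 hf.2⟩

/-- **The equation clause of `DefinableDcEquations` for every threshold in the window
`((m(n) - n + 2)² + 1)(log₂ n + 1) ≤ c·n` eventually** (thresholds `m(n) ≤ n + Θ(√(c n/log n))`):
level `a = 14c + 11`, `q = 0`, `H = certPoly n ((m(n) - n + 2)² + 1)`.  This is the full range of
thresholds the Eagon–Northcott/Macaulay method certifies with `poly(N)`-size equations; the crux's
own threshold `2^(C (log₂ n + 1)²)` is untouched. [cite: Matsumura1987, Thm. 13.10] -/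
theorem dcEquations_of_threshold_window (c : ℕ) (m : ℕ → ℕ) {n₁ : ℕ}
    (hm : ∀ n, n₁ ≤ n → ((m n - n + 2) * (m n - n + 2) + 1) * (Nat.log 2 n + 1) ≤ c * n) :
    ∃ a n₀ : ℕ, ∀ n ≥ n₀, ∃ q : ℕ, q ≤ (Nat.choose (2 * n) n) ^ a ∧
      ∃ H : MvPolynomial (↥(degLEMonomials n) ⊕ Fin q) ℂ,
        complexity H ≤ (Nat.choose (2 * n) n) ^ a ∧ H.totalDegree ≤ (Nat.choose (2 * n) n) ^ a ∧
        boolSum H ≠ 0 ∧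
        ∀ f : MvPolynomial (Fin n) ℂ, f.totalDegree ≤ n → determinantalComplexity f ≤ m n →
          eval (coeffVector (degLEMonomials n) f) (boolSum H) = 0 := by
  refine ⟨14 * c + 11, max n₁ (2 ^ c), fun n hn => ?_⟩
  have hk := hm n ((le_max_left _ _).trans hn)
  have hw : (m n - n + 2) * (m n - n + 2) < (m n - n + 2) * (m n - n + 2) + 1 := Nat.lt_succ_self _
  have hwn : (m n - n + 2) * (m n - n + 2) + 1 ≤ n :=
    window_le ((le_max_right _ _).trans hn) (by omega) hk
  have hn2 : 2 ≤ n := by nlinarith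
  refine ⟨0, Nat.zero_le _, rename Sum.inl (certPoly n ((m n - n + 2) * (m n - n + 2) + 1)),
    ?_, ?_, ?_, ?_⟩
  · exact (complexity_rename_le_holds' _ _).trans
      (certPoly_mem_distinguishers_of_window hn2 (by omega) hwn hk).1
  · exact (totalDegree_rename_le _ _).trans
      (certPoly_mem_distinguishers_of_window hn2 (by omega) hwn hk).2
  · rw [boolSum_rename_inl_zero]
    exact certPoly_ne_zero (by omega) hwn
  · intro f hdeg hdc
    rw [boolSum_rename_inl_zero]
    exact eval_certPoly_eq_zero_of_dc_le_add hw hn2 f hdeg (hdc.trans le_add_tsub)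

end Summit.ValiantsHypothesis.ValiantsHypothesis.Theorems.BarrierLever.DcConstantExcess

end
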